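import Summits.BirchSwinnertonDyer.BirchSwinnertonDyer.Theorems.PrintX9MuPartStabilizedWeakLetters
import Summits.BirchSwinnertonDyer.BirchSwinnertonDyer.Theorems.PrintX9HowardContainmentLightFramePinnedOfPrintSharpOfMuStabilized
import HarnessLib

/-!
# The deciding crux `PrintX9.HowardContainmentLightFramePinnedOfPrintSharp` (stmt-BirchSwinnertonDyer-27077) from the L∃ μ-letter
# `HeegnerMuPartStabilized.MuPartStabilizedCoherentPair` — CONDITIONAL CLOSER (row 9)

Cell `pub/bsd-print-x9`, LEAD `bsd-line-x9-p1` (g2, μ-item custody), `--supports` stmt-BirchSwinnertonDyer-27077. The tribunal-w g9 FINDING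
MU-LETTER-∀C (STATUS 11:40:42Z): the shared ∀C letter `MuPartStabilizedOfPrint` is instantiated by every consumer ONLY at the engine's
coherent stabilised datum, and `∀ C` ⟸ `C₀` needs Shimura reciprocity at conductor `p^j` (not in the tree); the WEAKER letter L∃
(`MuPartStabilizedCoherentPair`, x10b-p1 LEAD g4 `Theorems/PrintX9MuPartStabilizedWeakLetters.lean`: the road EXPORTS its coherent pair
`(C, F)` on `(Dt, β)` with both envelopes and the μ-inequality AT THAT `C`; `…_of_print : ∀C-letter → L∃`) closes the same parents.
This file is that closer for row 9: p624590 §2 with its ONE engine line replaced by the hypothesis. Nothing asserted about L∃;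
no named fact introduced; no `sorry`; «beyond-print theorem»: no. BSD is NOT proved by this file; no summit statement is proved by it.
-/

set_option linter.dupNamespace false
set_option autoImplicit false

noncomputable section

open scoped Classical Pointwise
open Literature Literature.NumberTheory.EllipticCurves WeierstrassCurve
  Literature.NumberTheory.EllipticCurves.ModularForms
open Summit.BirchSwinnertonDyer.BirchSwinnertonDyer.Theses.PrintX9

namespace Summit.BirchSwinnertonDyer.BirchSwinnertonDyer.Theorems.PrintX9SharpMuCoherentPair

/-- **Crux 27077 from the L∃ letter `HeegnerMuPartStabilized.MuPartStabilizedCoherentPair`** (BY NAME on the route decl; tribunal-w g9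
sketch `mu-letter-closer27077-of-coherentpair-g9.sketch.lean` §2 re-homed): p624590 §2 with the engine call replaced
by the hypothesis — `p ∤ h_K` ↦ `PrintX9Rung.stmt_coprimeTied hMZ` (MZ26 Cor. 4.6, PRINT); `p ∣ h_K` ↦ the road's exported
pair `(C, F)` on `(Dt, H.β)`, torsion of `𝔖/Λκ_C` from `hNV` (CGLS 4.1.1), `I(ℋ_F) ⊆ I(Λκ_C)` from the exported forward
envelope, `(p^m)·I(Λκ_C)² ⊆ char(𝒳_tors)` from `hCGS` (CGS 6.5.2), the exported inequality at `(D, C, X)` and the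
promotion. CONDITIONAL; credits nothing by itself.
[cite: MastellaZerman2026, Cor. 4.6] [cite: CastellaGrossiLeeSkinner2022, Thm. 4.1.1, Rem. 4.1.4]
[cite: CastellaGrossiSkinner2025, Thm. 6.5.2] [cite: Howard2004HeegnerKolyvagin, Thm. 2.2.10] -/
theorem howardContainmentLightFramePinnedOfPrintSharp_of_muPartStabilizedCoherentPair (hE : HeegnerMuPartStabilized.MuPartStabilizedCoherentPair) :
    Summit.BirchSwinnertonDyer.BirchSwinnertonDyer.Theses.PrintX9.HowardContainmentLightFramePinnedOfPrintSharp := by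
  have s_cop := Summit.BirchSwinnertonDyer.BirchSwinnertonDyer.Theorems.PrintX9Rung.stmt_coprimeTied
  intro hMZ hNV hCGS hTw W _ _ p _ _ K _ _ hX9 hK hodd h3 hHN hHp hirr κ hκ γ hγ Dt H ιC hc hrk hfin
  letI : Algebra K ℂ := ιC.toAlgebra
  let jbar : AlgebraicClosure K →+* ℂ :=
    (IsAlgClosed.lift (R := K) (M := ℂ) (S := AlgebraicClosure K)).toRingHom
  by_cases hhK : p ∣ NumberField.classNumber K
  · obtain ⟨D⟩ := LambdaAdicSelmerDataExists.nonempty_lambdaAdicSelmerData (W.baseChange K) p κ hγ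
    obtain ⟨X⟩ := (W.baseChange K).nonempty_selmerDualData_holds κ γ hγ
    have hp : p.Prime := Fact.out
    have hX9' := Summit.BirchSwinnertonDyer.BirchSwinnertonDyer.Rank1Residual.classX9_census_of_classX9 W p hX9
    have hp_odd : Odd p := hp.odd_of_ne_two hX9'.ne_two
    have hyp := Summit.BirchSwinnertonDyer.Rank1Residual.X9.thm413Hypotheses_of_lightFrame hX9' hK hodd h3 hHN
      hHp hκ hγ
    -- the road's EXPORTED coherent pair `(C, F)` on `(Dt, H.β)` with its envelopes and the inequality at `C`
    obtain ⟨C, F, -, hFDt, -, -, hfwd, ⟨g, hg, hrev⟩, hineq⟩ :=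
      hE (W.conductorNorm ℤ) W K p κ γ jbar hyp hX9'.not_hasCM hX9'.irr hirr hX9'.hasPadicScalarImage hHp hhK
        hX9'.not_dvd_conductorNorm (fun k ↦ hTw K p hp_odd hK κ hκ jbar k)
        (card_ringClassGalOver_prime_one_of_frame hK hodd h3 hp hHp jbar) Dt H.β H.dvd_sq_sub D X
    -- CGLS Thm. 4.1.1 and CGS Thm. 6.5.2 BY NAME at `(D, C)`, `(D, C, X)`
    have h411 : CastellaGrossiLeeSkinner2022.thm411_torsionFree_heegnerClass_ne_bot_quotient_isTorsion.{0} := hNV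
    have h652 : CastellaGrossiSkinner2025.thm652_stabilized_rankOne_charIdeal_torsion_dvd_pLocalized.{0} := hCGS
    obtain ⟨⟨hfinS, -⟩, hfinX, -, -⟩ := h652 (W.conductorNorm ℤ) W K p κ γ jbar hyp D C X
    haveI := hfinS
    haveI := hfinX
    haveI : IsNoetherian (IwasawaAlgebra p) X.X := isNoetherian_of_isNoetherianRing_of_finite _ _
    haveI : Module.Finite (IwasawaAlgebra p) (Submodule.torsion (IwasawaAlgebra p) X.X) := inferInstance
    haveI : Module.Finite (IwasawaAlgebra p)
        (D.S ⧸ CastellaGrossiLeeSkinner2022.stabilizedHeegnerModule D C) := inferInstance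
    have htorC : Module.IsTorsion (IwasawaAlgebra p)
        (D.S ⧸ CastellaGrossiLeeSkinner2022.stabilizedHeegnerModule D C) :=
      CastellaGrossiLeeSkinner2022.isTorsion_quotient_stabilizedHeegnerModule_of_thm411 h411 hyp D C
    have htorF : Module.IsTorsion (IwasawaAlgebra p) (D.S ⧸ heegnerModule D F) :=
      isTorsion_quotient_heegnerModule_of_smul_stabilizedHeegnerModule_le D F C hg hrev htorC
    -- `I(ℋ_F) ⊆ I(Λκ_C)` (exported forward envelope)
    have henv : heegnerCharIdeal D F ≤ CastellaGrossiLeeSkinner2022.stabilizedHeegnerCharIdeal D C :=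
      heegnerCharIdeal_le_stabilizedHeegnerCharIdeal_of_le D F C htorF hfwd
    -- `(p^m) · I(Λκ_C)² ⊆ char(𝒳_tors)`
    obtain ⟨m, hm⟩ := CastellaGrossiSkinner2025.span_pow_mul_sq_le_charIdeal_torsion_of_thm652_stabilized h652
      hyp D C X
    -- the exported inequality at `(D, C, X)` and the promotion
    have hμ := hineq hfinS hfinX htorC
    have hC2 : CastellaGrossiLeeSkinner2022.stabilizedHeegnerCharIdeal D C ^ 2 ≤
        Module.charIdeal (IwasawaAlgebra p) (Submodule.torsion (IwasawaAlgebra p) X.X) := by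
      rw [CastellaGrossiLeeSkinner2022.stabilizedHeegnerCharIdeal_def] at hm ⊢
      exact IwasawaAlgebra.sq_charIdeal_le_charIdeal_of_span_p_pow_mul_le_of_lengthAt_le_two_mul
        (Submodule.torsion_isTorsion (R := IwasawaAlgebra p) (M := X.X)) htorC hμ hm
    exact ⟨jbar, D, F, X, hFDt, (Ideal.pow_right_mono henv 2).trans hC2⟩
  · obtain ⟨D, F, X, hF, hle⟩ := s_cop hMZ W p K hX9 hK hodd h3 hHN hHp hirr κ hκ γ hγ Dt H ιC jbar hc hrk hfin hhK
    exact ⟨jbar, D, F, X, hF, hle⟩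


end Summit.BirchSwinnertonDyer.BirchSwinnertonDyer.Theorems.PrintX9SharpMuCoherentPair

end
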